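import Summits.BirchSwinnertonDyer.BirchSwinnertonDyer.Theorems.CumulativeHeegnerLeopoldtCumulativeHeegnerInclusionAtThreeTraceZeroHeegnerModuleTorsion
import Summits.BirchSwinnertonDyer.Rank1Residual.Additive.UnramifiedBaseChange
import Literature.NumberTheory.EllipticCurves.HeegnerNormPointExistenceAnyConductorProofs
import Literature.NumberTheory.EllipticCurves.CornutVatsal2007.GoodCMPointsLevelPSquared
import Literature.NumberTheory.DiophantineGeometry.ConductorAdditiveProofs
import Literature.NumberTheory.DiophantineGeometry.ConductorRingOfIntegersProofs
import Literature.NumberTheory.EllipticCurves.SzpiroLocalDataProofs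
import HarnessLib

/-!
# Route `CumulativeHeegnerLeopoldt`, crux K1 `CumulativeHeegnerInclusionAtThree` (stmt-BirchSwinnertonDyer-24198),
# stub A (= crux stmt-26896): the Heegner-module barrier ON THE ACTUAL OBJECTS — Cornut–Vatsal families exist on
# the Leopoldt cell, their traces are torsion, their points are non-trivial, and `ℋ_∞(F) = ⊥` for them

Width prover bsd-line-chl-k1-p1-w2 g6, `--supports stmt-BirchSwinnertonDyer-24198`. THEOREMS ONLY (no definition, no
named fact, no `sorry`). Closes the OBJECT DEFICIT (a′) of the K1 lineage memos (A-LINE-INPUT-AUDIT §2, BARRIER-MEMO-A26896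
§3/§3b): the barrier lemmas of LEAD g3 (`…TraceZeroHeegnerModuleTorsion.heegnerModule_eq_bot_on_leopoldtCell_of_(eventually_)
traceTorsion`, p622685/p623095) take a Heegner family `F` with torsion traces as INPUT; until now the tree produced
Heegner families only for `p ∤ N`.

* §1 `sq_dvd_conductorNorm_of_addv_three` — an additive `3` has `f₃ ≥ 2`, so `9 ∣ N_E` (Silverman ATAEC IV.10.2 (c), tree
  `two_le_conductorExponent_iff_holds`); on the cell (`ClassO6 W 3`) this is Cornut–Vatsal's `δ = v₃(N) ≥ 2`.
* §2 `exists_heegnerFamily_on_leopoldtCell` — UNCONDITIONAL: for every frame of the cell (any `K`, `Dt`, `β`, `jbar`, any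
  `ℤ₃`-extension `κ`) a Heegner family tied to `(Dt, β)` EXISTS (`exists_heegnerFamily_Dt_eq_of_dvd_sq_sub`, p640007:
  Darmon Thm. 3.6 at every conductor, `9 ∣ N` allowed).
* §3 `exists_heegnerFamily_heegnerModule_eq_bot_on_leopoldtCell` — CONDITIONAL on the ONE named fact
  `CornutVatsal2007.exists_heegnerFamily_traceTorsion_of_sq_dvd` (p640511; CV 2007 Lemma 4.9 (iii)/6.14 + Thm. 1.10 at
  `δ ≥ 2`): on the cell, for every anticyclotomic `κ` with generator `γ`, every `Λ`-adic Selmer datum `D`, orientation `β`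
  and `jbar`, there is a Heegner family `F` tied to `(Dt, β)` with TORSION traces from some layer on, whose Howard/Perrin-Riou
  module VANISHES, `ℋ_∞(F) = ⊥`, and — when `3 ∤ h_K` — whose points `z_j`, `j ≥ j₀`, are of INFINITE order. So the
  Howard-currency degeneracy (R1) of BARRIER-MEMO-A26896 bites on GENUINE, NON-TRIVIAL Heegner families of the cell, not
  only on hypothetical trace-zero ones: every `heegnerCharIdeal`/`heegnerModuleIndex`-valued statement about such an `F` is
  Heegner-free (`heegnerCharIdeal D F = char_Λ 𝔖`, §3 `heegnerCharIdeal_eq_charIdeal_…`).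
HONEST FRAMING: plumbing of two Literature items landed this session into LEAD g3's lemma; a barrier datum for the
ideation of A 26896 (any A-line must use the CUMULATIVE / tempered classes, not `ℋ_∞`), not a step toward K1; A and K1
stay OPEN; BSD is not proved by any of this.

References: Cornut–Vatsal 2007 (LMS LNS 320) Lemma 4.9 (iii), Lemma 6.14, Thm. 1.10; [PerrinRiou1987BSMF] §3.4 Prop. 10;
[Howard2004HeegnerKolyvagin] §3.3; [SilvermanATAEC1994] IV.10.2.
-/

set_option autoImplicit false
-- `Summit.BirchSwinnertonDyer.BirchSwinnertonDyer.…`: the summit/problem path repeats by design (D-0017)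
set_option linter.dupNamespace false

noncomputable section

open scoped Classical

open WeierstrassCurve IsDedekindDomain Literature.NumberTheory.EllipticCurves
  Literature.NumberTheory.EllipticCurves.ModularForms

namespace Summit.BirchSwinnertonDyer.BirchSwinnertonDyer.Theorems.CumulativeHeegnerInclusionAtThreeCornutVatsalFamily

/-! ## §1 `9 ∣ N` at an additive `3` -/

/-- **An additive prime `3` divides the conductor at least twice**: `Addv W 3 → 3² ∣ N_E` (`f_v ≥ 2` iff additive,
Silverman ATAEC IV.10.2 (c) = tree `two_le_conductorExponent_iff_holds`; `N_E = ∏ p^{f_p}`,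
`factorization_conductorNorm_primesEquiv_symm`). [cite: SilvermanATAEC1994, IV.10.2 (c)] -/
theorem sq_dvd_conductorNorm_of_addv_three (W : WeierstrassCurve ℚ) [W.IsElliptic] [W.IsGloballyMinimal]
    (hadd : Literature.NumberTheory.EllipticCurves.Rank1Residual.Addv W 3) : 3 ^ 2 ∣ W.conductorNorm ℤ := by
  haveI : Fact (Nat.Prime 3) := ⟨Nat.prime_three⟩
  set u : HeightOneSpectrum (NumberField.RingOfIntegers ℚ) :=
    (Rat.HeightOneSpectrum.primesEquiv (R := NumberField.RingOfIntegers ℚ)).symm ⟨3, Nat.prime_three⟩ with hudef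
  have hadd' : W.HasAdditiveReductionAt u :=
    Summit.BirchSwinnertonDyer.Rank1Residual.Additive.hasAdditiveReductionAt_of_addv W 3 hadd
  haveI : Finite (IsLocalRing.ResidueField (u.adicCompletionIntegers ℚ)) :=
    HeightOneSpectrum.finite_residueField_adicCompletionIntegers ℚ u
  haveI : PerfectField (IsLocalRing.ResidueField (u.adicCompletionIntegers ℚ)) := PerfectField.ofFinite
  have h2 : 2 ≤ W.conductorExponent u := (W.two_le_conductorExponent_iff_holds u).mpr hadd'
  rw [W.conductorExponent_ringOfIntegers_eq u, hudef, Equiv.apply_symm_apply] at h2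
  have hN : W.conductorNorm ℤ ≠ 0 := (W.conductorNorm_pos_holds).ne'
  refine (Nat.prime_three.pow_dvd_iff_le_factorization hN).mpr ?_
  rw [W.factorization_conductorNorm_primesEquiv_symm ⟨3, Nat.prime_three⟩]
  exact h2

/-! ## §2 Heegner families exist on the Leopoldt cell (unconditional) -/

section Cell

variable {K : Type} [Field K] [NumberField K] {W : WeierstrassCurve ℚ} [W.IsElliptic] [W.IsGloballyMinimal]
  {N : ℕ} [NeZero N]

omit [W.IsGloballyMinimal] in
/-- **Heegner families exist on the Leopoldt cell** (indeed for any `W/ℚ` elliptic, `K` imaginary quadratic and any level):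
for every parametrisation datum `Dt`, orientation `β` (`4N ∣ β² − d_K`), embedding `jbar : K̄ → ℂ` and `ℤ₃`-extension `κ`
there is `F : HeegnerFamily N W K κ jbar` with `F.Dt = Dt`, `F.β = β` — `9 ∣ N` notwithstanding (Darmon 2004 Thm. 3.6 at
EVERY conductor: `Literature.….exists_heegnerFamily_Dt_eq_of_dvd_sq_sub`). The object the barrier lemmas quantify over is
therefore never vacuous. [cite: Darmon2004, Thm. 3.6 (PDF pp. 43–44)] [cite: Howard2004HeegnerKolyvagin, §3.3] -/
theorem exists_heegnerFamily_on_leopoldtCell (hK : IsImaginaryQuadratic K) (κ : ZpExtension K 3)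
    (Dt : ModularParametrizationData W N) {β : ℤ} (hβ : (4 * N : ℤ) ∣ β ^ 2 - NumberField.discr K)
    (jbar : AlgebraicClosure K →+* ℂ) :
    ∃ F : HeegnerFamily N W K κ jbar, F.Dt = Dt ∧ F.β = β :=
  exists_heegnerFamily_Dt_eq_of_dvd_sq_sub hK κ Dt hβ jbar

/-! ## §3 Cornut–Vatsal families on the cell: torsion traces, non-triviality, `ℋ_∞ = ⊥` -/

/-- **THE BARRIER ON THE ACTUAL OBJECTS.** On the Leopoldt cell of crux K1 / A (`ClassO6 W 3`: wild additive `3`, so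
`9 ∣ N`; non-anomalous rational line; `N = N_E`; `K` imaginary quadratic Heegner for `N`), granted the named fact
`CornutVatsal2007.exists_heegnerFamily_traceTorsion_of_sq_dvd` (Cornut–Vatsal 2007, Lemma 4.9 (iii) with Lemma 6.14, and
Thm. 1.10 at `χ₀ = 1`, for `δ = v₃(N) ≥ 2`): for every ANTICYCLOTOMIC `ℤ₃`-extension `κ` with topological generator `γ`,
every `Λ`-adic Selmer datum `D`, every orientation `β` and embedding `jbar`, there are a Heegner family `F` tied to
`(Dt, β)` and an index `j₀` such that (i) every trace `Tr_{K_{j+1}/K_j} z_{j+1} = ∑_{i<3} γ^{3^j i} • z_{j+1}`, `j ≥ j₀`, is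
TORSION; (ii) Howard's / Perrin-Riou's `Λ`-adic Heegner module VANISHES: `ℋ_∞(F) = ⊥` (LEAD g3's
`heegnerModule_eq_bot_on_leopoldtCell_of_eventually_traceTorsion`, whose torsion input `E(K_∞)[3^∞] = 0` is the cell
theorem p615628); (iii) if `3 ∤ h_K`, the points `z_j`, `j ≥ j₀`, are of INFINITE order (Mazur/Cornut–Vatsal
non-triviality) — so (ii) is not an artefact of a trivial family. CONDITIONAL on the one named fact; a barrier datum for
the ideation of A 26896 (Howard-currency statements are Heegner-free on the cell), not a step toward BSD.
[cite: CornutVatsal2007, Lemma 4.9 (iii) and Thm. 1.10] [cite: PerrinRiou1987BSMF, §3.4 Prop. 10] -/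
theorem exists_heegnerFamily_heegnerModule_eq_bot_on_leopoldtCell
    (hCV : CornutVatsal2007.exists_heegnerFamily_traceTorsion_of_sq_dvd)
    (hO6 : Summit.BirchSwinnertonDyer.Rank1Residual.Additive.ClassO6 W 3)
    (hline : ∃ Φ : AddSubgroup (WeierstrassCurve.geomTorsion W ((3 : ℕ) : ℤ)),
        Literature.NumberTheory.EllipticCurves.Rank1Residual.IsRationalLine W 3 Φ ∧
        ∀ (v : IsDedekindDomain.HeightOneSpectrum (NumberField.RingOfIntegers ℚ)),
          ((3 : ℕ) : NumberField.RingOfIntegers ℚ) ∈ v.asIdeal → ∀ 𝔓 ∈ v.primesAbove,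
          ¬ (∀ g ∈ 𝔓.decompositionSubgroup (Field.absoluteGaloisGroup ℚ), ∀ P ∈ Φ, g • P = P) ∧
          ¬ (∀ g ∈ 𝔓.decompositionSubgroup (Field.absoluteGaloisGroup ℚ),
              ∀ P : WeierstrassCurve.geomTorsion W ((3 : ℕ) : ℤ), g • P - P ∈ Φ))
    (hN : W.conductorNorm ℤ = N) (hK : IsImaginaryQuadratic K) (hHg : SatisfiesHeegnerHypothesis N K)
    (κ : ZpExtension K 3) (hκ : κ.IsAnticyclotomic) (γ : Field.absoluteGaloisGroup K) (hγ : κ.IsTopGenerator γ)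
    (D : (W.baseChange K).LambdaAdicSelmerData κ γ) (Dt : ModularParametrizationData W N) {β : ℤ}
    (hβ : (4 * N : ℤ) ∣ β ^ 2 - NumberField.discr K) (jbar : AlgebraicClosure K →+* ℂ) :
    ∃ (F : HeegnerFamily N W K κ jbar) (j₀ : ℕ), F.Dt = Dt ∧ F.β = β ∧
      (∀ j, j₀ ≤ j → ∃ m : ℤ, m ≠ 0 ∧ m • (∑ i ∈ Finset.range 3, (γ ^ (3 ^ j * i)) • F.z (j + 1)) = 0) ∧
      heegnerModule D F = ⊥ ∧
      (¬ 3 ∣ NumberField.classNumber K → ∀ j, j₀ ≤ j → ¬ IsOfFinAddOrder (F.z j)) := by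
  have h9 : 3 ^ 2 ∣ N := by
    rw [← hN]; exact sq_dvd_conductorNorm_of_addv_three W hO6.2.1
  obtain ⟨F, j₀, hDt, hβ', hTT, hNT⟩ :=
    hCV N W K hK hHg 3 (by norm_num) h9 hN κ hκ γ hγ Dt β hβ jbar
  refine ⟨F, j₀, hDt, hβ', hTT, ?_, hNT⟩
  exact CumulativeHeegnerInclusionAtThreeTraceZero.heegnerModule_eq_bot_on_leopoldtCell_of_eventually_traceTorsion
    hO6 hline hN hK hHg hγ D F j₀ hTT

/-- **Corollary (Howard currency is Heegner-free on the cell).** Under the same hypotheses the Cornut–Vatsal family `F` has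
`heegnerCharIdeal D F = char_Λ(𝔖)` — Perrin-Riou's `I(ℋ_∞) = char(𝔖/ℋ_∞)` with `ℋ_∞ = 0` — so a divisibility of the shape
`char(X_tors) ∣ I(ℋ_∞)²` (Howard 2004 Thm. B / CGS Thm. C currency) carries no Heegner information for it.
CONDITIONAL on the named fact. [cite: PerrinRiou1987BSMF, §1 p. 405 (I(H_∞))] [cite: CornutVatsal2007, Lemma 4.9 (iii)] -/
theorem exists_heegnerFamily_heegnerCharIdeal_eq_charIdeal_on_leopoldtCell
    (hCV : CornutVatsal2007.exists_heegnerFamily_traceTorsion_of_sq_dvd)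
    (hO6 : Summit.BirchSwinnertonDyer.Rank1Residual.Additive.ClassO6 W 3)
    (hline : ∃ Φ : AddSubgroup (WeierstrassCurve.geomTorsion W ((3 : ℕ) : ℤ)),
        Literature.NumberTheory.EllipticCurves.Rank1Residual.IsRationalLine W 3 Φ ∧
        ∀ (v : IsDedekindDomain.HeightOneSpectrum (NumberField.RingOfIntegers ℚ)),
          ((3 : ℕ) : NumberField.RingOfIntegers ℚ) ∈ v.asIdeal → ∀ 𝔓 ∈ v.primesAbove,
          ¬ (∀ g ∈ 𝔓.decompositionSubgroup (Field.absoluteGaloisGroup ℚ), ∀ P ∈ Φ, g • P = P) ∧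
          ¬ (∀ g ∈ 𝔓.decompositionSubgroup (Field.absoluteGaloisGroup ℚ),
              ∀ P : WeierstrassCurve.geomTorsion W ((3 : ℕ) : ℤ), g • P - P ∈ Φ))
    (hN : W.conductorNorm ℤ = N) (hK : IsImaginaryQuadratic K) (hHg : SatisfiesHeegnerHypothesis N K)
    (κ : ZpExtension K 3) (hκ : κ.IsAnticyclotomic) (γ : Field.absoluteGaloisGroup K) (hγ : κ.IsTopGenerator γ)
    (D : (W.baseChange K).LambdaAdicSelmerData κ γ) (Dt : ModularParametrizationData W N) {β : ℤ}
    (hβ : (4 * N : ℤ) ∣ β ^ 2 - NumberField.discr K) (jbar : AlgebraicClosure K →+* ℂ) :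
    ∃ (F : HeegnerFamily N W K κ jbar) (j₀ : ℕ), F.Dt = Dt ∧ F.β = β ∧
      heegnerCharIdeal D F = Module.charIdeal (IwasawaAlgebra 3) D.S ∧
      (¬ 3 ∣ NumberField.classNumber K → ∀ j, j₀ ≤ j → ¬ IsOfFinAddOrder (F.z j)) := by
  obtain ⟨F, j₀, hDt, hβ', -, hbot, hNT⟩ :=
    exists_heegnerFamily_heegnerModule_eq_bot_on_leopoldtCell hCV hO6 hline hN hK hHg κ hκ γ hγ D Dt hβ jbar
  refine ⟨F, j₀, hDt, hβ', ?_, hNT⟩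
  rw [heegnerCharIdeal]
  exact Module.charIdeal_eq_of_linearEquiv (Submodule.quotEquivOfEqBot _ hbot)

end Cell

end Summit.BirchSwinnertonDyer.BirchSwinnertonDyer.Theorems.CumulativeHeegnerInclusionAtThreeCornutVatsalFamily

end
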